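import Summits.QuantumFields.YangMills.Theorems.BalabanUVNodesN15KingModelFreeRGBlockSpinEngine
import Summits.QuantumFields.YangMills.Theorems.BalabanUVNodesN15KingModelFreeRGThm31Letters
import HarnessLib

/-!
# BalabanUVNodes ∕ N15 — THE KING-MODEL RUNG, FREE-FIELD EDITION (PART Τ-i₃): **KING'S RENORMALIZATION TRANSFORMATION ITSELF, BY NAME** — the
# effective actions `S^{(k),1} = kingFreeS m k` of part Τ-e's datum `kingFreeRG` ARE THE ITERATES of the mass-preserving Gaussian block-spin
# transformation `T_{a,L}` (one step `S_{m+1}^{(k)} ↦ S_m^{(k+1)}` with the (2.20) rescaling, EVERY `k ≥ 0`) AND the ONE-SHOT transform `T_{a_k,L^k}` of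
# the bare action ((2.13)∕(2.15)) — the free massive lattice scalar field, `A = 0` (Track A, DAG node N15 = NE2; FAN-OUT v1.1 §N15 s3 «KING-MODEL
# RUNG»; regen R453 (b))

HONEST FRAMING.  Count-neutral (cell `pub-ymgap`, seat `pub-ymgap-dag-n15-e` g20; `--supports stmt-QuantumFields-27366 --as helper` = K3⁸
`SpineGivenEndpointR13SepCoPHV`).  TEMPLATE LITERATURE, `A = 0`, FREE FIELD.  Part Τ-e (`…FreeRGDatum`, seat g19) inhabited the typer's schema
`King1986.ContinuumLimit.RGData` with the free massive scalar field and DECLARED (HONEST SCOPE (i)) that its effective actions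
`S m k = ½⟨φ, Δ^{(k)}φ⟩ + ln 𝒩(Δ^{(k)})` were given in the CLOSED Gaussian form of King's §3.6, «not re-derived from the k-fold integral (2.4)–(2.6) ∕
(2.13)–(2.15); the composition law `T_{a,L}^k = T_{a_k,L^k}` at the level of integrals NOT formalised».  THIS FILE REMOVES THAT LINE (third file of
PART Τ-i: Τ-i₁ `…FreeRGBlockSpinGauss` = one Gaussian block-spin step evaluated + mass preservation; Τ-i₂ `…FreeRGBlockSpinEngine` = King's operators
are the step's operators, (2.13)–(2.14) as a Gaussian integral, transports):
 (§1) `kingBlockAvg` ∕ `kingBlockAvgK` — King's RESCALED averaging operators: the block mean (2.10) followed by the canonical rescaling (2.20) of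
   the scalar field to unit spacing, `Q̃ = L^{(d−2)∕2}·Q_L` (one step) ∕ `Q̃_k = (L^k)^{(d−2)∕2}·Q_{L^k}` (`k` steps) — TWO definitions; and the OPERATOR
   IDENTITY OF THE STEP on the datum, `(L^d∕L²)·kingFreeOp m (k+1) = bsEff (aL^{d−2}) Q_L [kingFreeOp (m+1) k on L-blocks]` for EVERY `k ≥ 0`
   (`k = 0`: Τ-i₂'s bare step at `N = L`, `a_1 = a`; `k ≥ 1`: Τ-i₂'s iterated step = the tree's `King1986.Torus.effLaplacian_succ_flatten`);
 (§1) ★★★ `exp_neg_kingFreeS_succ` — THE RENORMALIZATION-GROUP STEP: for every depth `m`, every `k ≥ 0` and every field `φ′` on `T₁^{(k+1)}`,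
   `e^{−S_m^{(k+1)}(φ′)} = (a∕2π)^{|T₁^{(k+1)}|∕2} ∫ dφ_k e^{−(a∕2)Σ_y |φ′(y) − (Q̃φ_k)(y)|²} e^{−S_{m+1}^{(k)}(φ_k)}` with King's mass-one constant
   `N_{a,L} = (a∕2π)^{n∕2}` ((2.6)∕(2.15)): the level-`k` effective density at depth `m+1` (unit lattice `M₀L^{m+1}` per direction) is mapped to the
   level-`(k+1)` one at depth `m` (unit lattice `M₀L^m`) — including the FIRST step `k = 0` from the bare action `½⟨φ,(−Δ¹ + m²ε²)φ⟩ + ln𝒩`;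
 (§2) ★★ `exp_neg_kingFreeS_eq_blockSpin_bare` — (2.13)∕(2.15): `e^{−S_m^{(k)}} = T_{a_k,L^k}[e^{−S_{m+k}^{(0)}}]`, the `k`-fold transformation in ONE
   shot (block size `L^k`, constant `a_k = aK a L k`, rescaling `(L^k)^{(d−2)∕2}`), and `king215_freeField`: the two integral representations of
   `e^{−S_m^{(k+1)}}` (one more step on `S_{m+1}^{(k)}` ∕ one shot from the bare field at depth `m+k+1`) AGREE — (2.15)
   `T_{a,L}∘T_{a_k,L^k} = T_{a_{k+1},L^{k+1}}` read at the level of integrals for the free field.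
THE MATHEMATICS is in Τ-i₁∕Τ-i₂ (completing the square + translation invariance; Fubini for mass preservation; the operator composition law
[Ba1] (2.18)∕(2.21) for King's operators; Lebesgue measure on `ℝ^{Π ℤ∕K}` invariant under relabelling); this file supplies the two spellings of the unit
lattice (`L·(M₀L^m) = M₀L^{m+1}`, `torCongr`), the unit-lattice mass bookkeeping `m²ε_m² = L²·m²ε_{m+1}²`, the operator identity per `k`, and fires
Τ-i₂'s `density_transport_engine` on part Τ-g₁'s `e^{−S} = ρ_{Δ}` (`exp_neg_kingFreeS`).  WHY THE POWER `(d−2)∕2`: see Τ-i₂'s header — with the weight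
`e^{−(aL^{d−2}∕2)‖ψ−Q_Lφ‖²}` of (2.13) in level-`k` units the effective operator in `ψ` is `L^{d−2}Δ^{(k+1)}`, and `φ′ = L^{(d−2)∕2}ψ` carries `Δ^{(k+1)}`
((2.20) `G^ε = (ε∕η)^{2−d}G^η`); no other power reproduces `a_{k+1}` and the mass `m²ε_m²`.
HONEST SCOPE.  (i) `A = 0`, free field (`λ = 0`, no vector field, no counterterms), cubic torus, `h = g = 0` — as part Τ-e; (ii) `L ≥ 2`, `a > 0`,
`m² > 0`; (iii) what is identified is the DENSITY map `e^{−S^{(k)}} ↦ e^{−S^{(k+1)}}` of (2.4)∕(3.14) for the free field with King's normalisation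
((2.6): total mass one at every level — part Τ-g₁ `integral_exp_neg_kingFreeS`); King's (3.14) for the INTERACTING model (the `P^{(k),1}`, `E_k`, the
vector field) is not touched; (iv) (2.15) is read as the agreement of the two integral representations (§2), not as an abstract semigroup statement.
NOT Bałaban's objects; NOT a node discharge; nothing continuum-YM ∕ ℝ⁴ ∕ OS ∕ mass-gap ∕ Clay.  0 `sorry`; TWO definitions (`kingBlockAvg`,
`kingBlockAvgK`); standard axioms.  READING NOTE (ref-K READ-340, carried): all `𝒩(·)`, `e^{−S} = ρ` identities hold under the coercive letters
`0 < a`, `0 < m²`, `2 ≤ L` (hypotheses below); outside them `gaussNorm` is Bochner junk.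
Locators: [King1986] (2.4)–(2.6) p.652, (2.10) p.653, (2.13)–(2.16) p.653, (2.20) p.654, (2.21) p.654, (3.14)–(3.15) p.657, (3.89)–(3.90) pp.668–669.
-/

noncomputable section

namespace Summit.QuantumFields.YangMills.BalabanUVNodes.N15KingModelRung.FreeField

open Real Finset Matrix MeasureTheory
open Literature.MathematicalPhysics.QuantumFieldTheory.Balaban1983to89.QGQInverse (Coercive)
open Literature.MathematicalPhysics.QuantumFieldTheory.Balaban1983to89.B5Prop11Plancherel (Tor fine)
open Literature.MathematicalPhysics.QuantumFieldTheory.King1986 (aK aK_pos aK_one)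
open Literature.MathematicalPhysics.QuantumFieldTheory.King1986.ContinuumLimit (eps eps_pos)
open Literature.MathematicalPhysics.QuantumFieldTheory.King1986.Torus (effLaplacian lapF lapF_torCongr Qmat torCongr)

variable {d : ℕ}

/-! ## §1 ★★★ THE RENORMALIZATION-GROUP STEP `S_{m+1}^{(k)} ↦ S_m^{(k+1)}` BY NAME ON PART Τ-e's DATUM -/

section Step

variable (L : ℕ) [NeZero L] (M₀ : ℕ) [NeZero M₀]

omit [NeZero L] [NeZero M₀] in
/-- The two spellings of the unit lattice `T₁^{(k)}` at depth `m+1`: `L`-blocks over the depth-`m` cube, `L·(M₀L^m) = M₀L^{m+1}`.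
[cite: King1986, (2.21) p.654, (3.15) p.657] -/
theorem cubeSide_succ (m : ℕ) : ∀ μ, fine L (cubeSide (d := d) M₀ L m) μ = cubeSide (d := d) M₀ L (m + 1) μ := by
  intro μ
  show L * (M₀ * L ^ m) = M₀ * L ^ (m + 1)
  rw [pow_succ]
  ring

omit [NeZero L] [NeZero M₀] in
/-- The same `k` levels down: `L^k·(M₀L^m) = M₀L^{m+k}`. [cite: King1986, (2.21) p.654] -/
theorem cubeSide_add (m k : ℕ) : ∀ μ, fine (L ^ k) (cubeSide (d := d) M₀ L m) μ = cubeSide (d := d) M₀ L (m + k) μ := by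
  intro μ
  show L ^ k * (M₀ * L ^ m) = M₀ * L ^ (m + k)
  rw [pow_add]
  ring

/-- **KING'S RESCALED AVERAGING OPERATOR (one step)**: the block mean (2.10) `L^{−d}Σ_{x∈B(y)}φ_k(x)` from `T₁^{(k)}` (depth `m+1`) to `T₁^{(k+1)}`
(depth `m`) followed by the canonical rescaling (2.20) of the scalar field to unit lattice spacing, `(Q̃φ_k)(y) = L^{(d−2)∕2}·L^{−d}Σ_{x∈B(y)}φ_k(x)`
— the operator in `exp[−(a∕2)Σ_y|φ_{k+1}(y) − (Q̃φ_k)(y)|²]` of (3.14)–(3.15). [cite: King1986, (2.10) p.653, (2.20) p.654, (3.15) p.657] -/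
def kingBlockAvg (m : ℕ) (φ : Tor (cubeSide (d := d) M₀ L (m + 1)) → ℝ) : Tor (cubeSide (d := d) M₀ L m) → ℝ :=
  Real.sqrt (((L : ℝ) ^ d) / (L : ℝ) ^ 2) • (Qmat L (cubeSide (d := d) M₀ L m) *ᵥ (φ ∘ torCongr (cubeSide_succ L M₀ m)))

/-- **KING'S RESCALED AVERAGING OPERATOR (`k` steps at once)**: `(Q̃_kφ)(y) = (L^k)^{(d−2)∕2}·L^{−kd}Σ_{x∈B_k(y)}φ(x)` from the bare lattice
`T₁^{(0)}` at depth `m+k` to `T₁^{(k)}` at depth `m` — the operator of `T_{a_k,L^k}` (2.13). [cite: King1986, (2.10) p.653, (2.13) p.653, (2.20) p.654] -/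
def kingBlockAvgK (m k : ℕ) (φ : Tor (cubeSide (d := d) M₀ L (m + k)) → ℝ) : Tor (cubeSide (d := d) M₀ L m) → ℝ :=
  Real.sqrt ((((L ^ k : ℕ) : ℝ) ^ d) / ((L ^ k : ℕ) : ℝ) ^ 2)
    • (Qmat (L ^ k) (cubeSide (d := d) M₀ L m) *ᵥ (φ ∘ torCongr (cubeSide_add L M₀ m k)))

variable {L M₀}

omit [NeZero L] in
/-- The unit-lattice masses of consecutive depths: `m²ε_m² = L²·m²ε_{m+1}²`. [cite: King1986, (2.20) p.654, (4.4) p.670] -/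
theorem unitMassSq_succ (hL : 2 ≤ L) (msq : ℝ) (m : ℕ) :
    unitMassSq msq L m = (L : ℝ) ^ 2 * unitMassSq msq L (m + 1) := by
  have hL0 : (L : ℝ) ≠ 0 := by exact_mod_cast (show L ≠ 0 by omega)
  unfold unitMassSq eps
  field_simp
  ring

omit [NeZero L] in
/-- … and `k` depths apart: `m²ε_m² = (L^k)²·m²ε_{m+k}²`. [cite: King1986, (2.20) p.654] -/
theorem unitMassSq_add (hL : 2 ≤ L) (msq : ℝ) (m k : ℕ) :
    unitMassSq msq L m = ((L ^ k : ℕ) : ℝ) ^ 2 * unitMassSq msq L (m + k) := by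
  have hL0 : (L : ℝ) ≠ 0 := by exact_mod_cast (show L ≠ 0 by omega)
  unfold unitMassSq eps
  push_cast
  rw [pow_add]
  field_simp

/-- THE OPERATOR IDENTITY OF THE STEP on the datum: `(L^d∕L²)·(kingFreeOp m (k+1)) = bsEff (aL^{d−2}) Q_L T_k` where `T_k` is the level-`k` operator at
depth `m+1` read on `L`-blocks over the depth-`m` cube (`k = 0`: the bare action, Τ-i₂ `smul_effLaplacian_bare_eq_bsEff`; `k ≥ 1`: Τ-i₂
`smul_effLaplacian_succ_eq_bsEff`). [cite: King1986, (2.13)–(2.16) p.653, (2.20) p.654, (3.14)–(3.15) p.657] -/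
theorem smul_kingFreeOp_succ_eq_bsEff {a msq : ℝ} (ha : 0 < a) (hL : 2 ≤ L) (hmsq : 0 < msq) (m k : ℕ) :
    (((L : ℝ) ^ d) / (L : ℝ) ^ 2) • kingFreeOp (d := d) L M₀ a msq m (k + 1)
      = bsEff (a * (((L : ℝ) ^ d) / (L : ℝ) ^ 2)) (Qmat L (cubeSide (d := d) M₀ L m))
          ((kingFreeOp (d := d) L M₀ a msq (m + 1) k).submatrix (torCongr (cubeSide_succ L M₀ m)) (torCongr (cubeSide_succ L M₀ m))) := by
  have hL1 : (1 : ℝ) < L := by exact_mod_cast (show 1 < L by omega)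
  have hm' : 0 < unitMassSq msq L (m + 1) := by unfold unitMassSq; exact mul_pos hmsq (pow_pos (eps_pos (by omega) _) 2)
  rcases Nat.eq_zero_or_pos k with hk | hk
  · -- the FIRST step, from the bare action
    subst hk
    have hT : (kingFreeOp (d := d) L M₀ a msq (m + 1) 0).submatrix (torCongr (cubeSide_succ L M₀ m)) (torCongr (cubeSide_succ L M₀ m))
        = lapF (fine L (cubeSide (d := d) M₀ L m)) 1 (unitMassSq msq L (m + 1)) := by
      ext x y
      rw [Matrix.submatrix_apply, kingFreeOp_zero]
      exact lapF_torCongr (cubeSide_succ L M₀ m) 1 (unitMassSq msq L (m + 1)) x y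
    rw [hT, kingFreeOp_succ]
    show (((L : ℝ) ^ d) / (L : ℝ) ^ 2) • effLaplacian (L ^ 1) (cubeSide (d := d) M₀ L m) (aK a L 1) (((L ^ 1 : ℕ) : ℝ) ^ 2)
        (unitMassSq msq L m) = _
    have h1 : effLaplacian (L ^ 1) (cubeSide (d := d) M₀ L m) (aK a L 1) (((L ^ 1 : ℕ) : ℝ) ^ 2) (unitMassSq msq L m)
        = effLaplacian L (cubeSide (d := d) M₀ L m) a ((L : ℝ) ^ 2) ((L : ℝ) ^ 2 * unitMassSq msq L (m + 1)) := by
      have hc : (((L ^ 1 : ℕ) : ℝ) ^ 2) = (L : ℝ) ^ 2 := by rw [pow_one]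
      rw [aK_one hL1, hc, ← unitMassSq_succ hL]
      exact effLaplacian_congrN (L ^ 1) (pow_one L) _ _ _ _
    rw [h1]
    exact smul_effLaplacian_bare_eq_bsEff L (cubeSide (d := d) M₀ L m) ha hm'
  · -- the ITERATED step `k ≥ 1`
    obtain ⟨j, rfl⟩ := Nat.exists_eq_add_of_le' hk
    have hT : (kingFreeOp (d := d) L M₀ a msq (m + 1) (j + 1)).submatrix (torCongr (cubeSide_succ L M₀ m)) (torCongr (cubeSide_succ L M₀ m))
        = effLaplacian (L ^ (j + 1)) (fine L (cubeSide (d := d) M₀ L m)) (aK a L (j + 1)) (((L ^ (j + 1) : ℕ) : ℝ) ^ 2)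
            (unitMassSq msq L (m + 1)) := by
      ext x y
      rw [Matrix.submatrix_apply, kingFreeOp_succ]
      exact effLaplacian_torCongr (L ^ (j + 1)) (cubeSide_succ L M₀ m) _ _ _ x y
    rw [hT, kingFreeOp_succ]
    show (((L : ℝ) ^ d) / (L : ℝ) ^ 2) • effLaplacian (L ^ (j + 1) * L) (cubeSide (d := d) M₀ L m) (aK a L (j + 1 + 1))
        (((L ^ (j + 1) * L : ℕ) : ℝ) ^ 2) (unitMassSq msq L m) = _
    rw [unitMassSq_succ hL msq m]
    exact smul_effLaplacian_succ_eq_bsEff (cubeSide (d := d) M₀ L m) L ha hL (Nat.succ_le_succ (Nat.zero_le j)) hm'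

/-- ★★★ **KING'S RENORMALIZATION-GROUP STEP FOR THE FREE FIELD, BY NAME ON THE DATUM `kingFreeRG`**: for `L ≥ 2`, `a > 0`, `m² > 0`, every depth `m`,
every `k ≥ 0` and every field `φ′` on the unit lattice `T₁^{(k+1)} = Π_μ ℤ∕(M₀L^m)`,
`exp(−S_m^{(k+1)}(φ′)) = (a∕2π)^{|T₁^{(k+1)}|∕2} · ∫ dφ_k exp[−(a∕2)Σ_y |φ′(y) − (Q̃φ_k)(y)|²] · exp(−S_{m+1}^{(k)}(φ_k))`,
the integral over the fields `φ_k` on `T₁^{(k)} = Π_μ ℤ∕(M₀L^{m+1})` with Lebesgue measure, `Q̃ = kingBlockAvg` the rescaled block mean ((2.10)+(2.20)) and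
`S = kingFreeS` part Τ-e's effective actions: `S_m^{(k+1)} = T_{a,L}[S_{m+1}^{(k)}]` EXACTLY, form (2.14) AND King's mass-one constant (2.6)∕(2.15) — for
`k = 0` the first step from the bare action `½⟨φ,(−Δ¹ + m²ε_{m+1}²)φ⟩`, for `k ≥ 1` the step `Δ^{(k)} ↦ Δ^{(k+1)}`.  This is (3.14)'s
«effective action at the k-th step … rescaled to have lattice spacing equal to one» for the free field, derived rather than posited.
[cite: King1986, (2.4)–(2.6) p.652, (2.13)–(2.15) p.653, (2.20) p.654, (3.14)–(3.15) p.657] -/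
theorem exp_neg_kingFreeS_succ {a msq : ℝ} (ha : 0 < a) (hL : 2 ≤ L) (hmsq : 0 < msq) (m k : ℕ)
    (φ' : Tor (cubeSide (d := d) M₀ L m) → ℝ) :
    Real.exp (-kingFreeS L M₀ a msq m (k + 1) φ')
      = Real.sqrt (a / (2 * π)) ^ Fintype.card (Tor (cubeSide (d := d) M₀ L m))
        * ∫ φ : Tor (cubeSide (d := d) M₀ L (m + 1)) → ℝ,
            Real.exp (-(1 / 2 : ℝ) * (a * ((φ' - kingBlockAvg L M₀ m φ) ⬝ᵥ (φ' - kingBlockAvg L M₀ m φ))))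
              * Real.exp (-kingFreeS L M₀ a msq (m + 1) k φ) := by
  have hL0 : (0 : ℝ) < L := by exact_mod_cast (show 0 < L by omega)
  have hs : 0 < ((L : ℝ) ^ d) / (L : ℝ) ^ 2 := by positivity
  obtain ⟨hδ, _⟩ := deltaFloor_pos_le L ha hL (show 0 < unitMassSq msq L (m + 1) from by
    unfold unitMassSq; exact mul_pos hmsq (pow_pos (eps_pos (by omega) _) 2))
  have hOpc := kingFreeOp_coercive (d := d) L M₀ ha hL hmsq (m + 1) k
  have hOps := kingFreeOp_transpose (d := d) L M₀ a msq (m + 1) k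
  have hE := smul_kingFreeOp_succ_eq_bsEff (d := d) (M₀ := M₀) ha hL hmsq m k
  rw [exp_neg_kingFreeS L M₀ ha hL hmsq m (k + 1) φ',
    density_transport_engine (torCongr (cubeSide_succ L M₀ m)) (Qmat L (cubeSide (d := d) M₀ L m)) hδ hOpc hOps ha hs hE.symm φ']
  congr 1
  refine integral_congr_ae (Filter.Eventually.of_forall fun φ => ?_)
  beta_reduce
  rw [exp_neg_kingFreeS L M₀ ha hL hmsq (m + 1) k φ]
  rfl

end Step

/-! ## §2 ★★ (2.13)∕(2.15): the `k`-fold transformation from the BARE field in one shot, and the agreement of the two representations -/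

section KFold

variable (L : ℕ) [NeZero L] (M₀ : ℕ) [NeZero M₀]

variable {L M₀}

/-- THE OPERATOR IDENTITY OF THE ONE-SHOT TRANSFORM: `((L^k)^d∕(L^k)²)·Δ^{(k)} = bsEff (a_k·(L^k)^{d−2}) Q_{L^k} (−Δ¹ + m²ε_{m+k}²)` (Τ-i₂'s bare step at
`N = L^k`, `a = a_k`). [cite: King1986, (2.13)–(2.14) p.653, (2.20) p.654] -/
theorem smul_kingFreeOp_eq_bsEff_bare {a msq : ℝ} (ha : 0 < a) (hL : 2 ≤ L) (hmsq : 0 < msq) (m : ℕ) {k : ℕ} (hk : 1 ≤ k) :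
    ((((L ^ k : ℕ) : ℝ) ^ d) / ((L ^ k : ℕ) : ℝ) ^ 2) • kingFreeOp (d := d) L M₀ a msq m k
      = bsEff (aK a L k * ((((L ^ k : ℕ) : ℝ) ^ d) / ((L ^ k : ℕ) : ℝ) ^ 2)) (Qmat (L ^ k) (cubeSide (d := d) M₀ L m))
          ((kingFreeOp (d := d) L M₀ a msq (m + k) 0).submatrix (torCongr (cubeSide_add L M₀ m k)) (torCongr (cubeSide_add L M₀ m k))) := by
  have hL1 : (1 : ℝ) < L := by exact_mod_cast (show 1 < L by omega)
  have hm' : 0 < unitMassSq msq L (m + k) := by unfold unitMassSq; exact mul_pos hmsq (pow_pos (eps_pos (by omega) _) 2)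
  have hT : (kingFreeOp (d := d) L M₀ a msq (m + k) 0).submatrix (torCongr (cubeSide_add L M₀ m k)) (torCongr (cubeSide_add L M₀ m k))
      = lapF (fine (L ^ k) (cubeSide (d := d) M₀ L m)) 1 (unitMassSq msq L (m + k)) := by
    ext x y
    rw [Matrix.submatrix_apply, kingFreeOp_zero]
    exact lapF_torCongr (cubeSide_add L M₀ m k) 1 (unitMassSq msq L (m + k)) x y
  rw [hT, kingFreeOp_of_pos L M₀ a msq m hk]
  show _ • effLaplacian (L ^ k) (cubeSide (d := d) M₀ L m) (aK a L k) (((L ^ k : ℕ) : ℝ) ^ 2) (unitMassSq msq L m) = _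
  rw [unitMassSq_add hL msq m k]
  exact smul_effLaplacian_bare_eq_bsEff (L ^ k) (cubeSide (d := d) M₀ L m) (aK_pos ha hL1 hk) hm'

/-- ★★ **(2.13)∕(2.15): `k` STEPS IN ONE SHOT FROM THE BARE FIELD** — for `k ≥ 1`, every depth `m` and every `φ′` on `T₁^{(k)} = Π ℤ∕(M₀L^m)`,
`exp(−S_m^{(k)}(φ′)) = (a_k∕2π)^{|T₁^{(k)}|∕2} · ∫ dφ exp[−(a_k∕2)Σ_y |φ′(y) − (Q̃_kφ)(y)|²] · exp(−S_{m+k}^{(0)}(φ))`, the integral over the BARE fields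
on `T_{ε} = Π ℤ∕(M₀L^{m+k})` (`a_k = aK a L k` (2.13), `Q̃_k = kingBlockAvgK` the `L^k`-block mean with the (2.20) rescaling `(L^k)^{(d−2)∕2}`,
`S_{m+k}^{(0)} = ½⟨φ,(−Δ¹ + m²ε_{m+k}²)φ⟩ + ln𝒩`): King's DEFINITION (2.13)–(2.14) of `Δ^{(k)}` through the transformation `T_{a_k,L^k}` of the bare
Gaussian, as an identity of integrals for part Τ-e's closed form. [cite: King1986, (2.4)–(2.6) p.652, (2.13)–(2.15) p.653, (2.20) p.654] -/
theorem exp_neg_kingFreeS_eq_blockSpin_bare {a msq : ℝ} (ha : 0 < a) (hL : 2 ≤ L) (hmsq : 0 < msq) (m : ℕ) {k : ℕ} (hk : 1 ≤ k)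
    (φ' : Tor (cubeSide (d := d) M₀ L m) → ℝ) :
    Real.exp (-kingFreeS L M₀ a msq m k φ')
      = Real.sqrt (aK a L k / (2 * π)) ^ Fintype.card (Tor (cubeSide (d := d) M₀ L m))
        * ∫ φ : Tor (cubeSide (d := d) M₀ L (m + k)) → ℝ,
            Real.exp (-(1 / 2 : ℝ) * (aK a L k * ((φ' - kingBlockAvgK L M₀ m k φ) ⬝ᵥ (φ' - kingBlockAvgK L M₀ m k φ))))
              * Real.exp (-kingFreeS L M₀ a msq (m + k) 0 φ) := by
  have hL1 : (1 : ℝ) < L := by exact_mod_cast (show 1 < L by omega)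
  have hN0 : (0 : ℝ) < ((L ^ k : ℕ) : ℝ) := by exact_mod_cast pow_pos (show 0 < L by omega) k
  have hs : 0 < ((((L ^ k : ℕ) : ℝ) ^ d) / ((L ^ k : ℕ) : ℝ) ^ 2) := by positivity
  have hak : 0 < aK a L k := aK_pos ha hL1 hk
  obtain ⟨hδ, _⟩ := deltaFloor_pos_le L ha hL (show 0 < unitMassSq msq L (m + k) from by
    unfold unitMassSq; exact mul_pos hmsq (pow_pos (eps_pos (by omega) _) 2))
  have hOpc := kingFreeOp_coercive (d := d) L M₀ ha hL hmsq (m + k) 0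
  have hOps := kingFreeOp_transpose (d := d) L M₀ a msq (m + k) 0
  have hE := smul_kingFreeOp_eq_bsEff_bare (d := d) (M₀ := M₀) ha hL hmsq m hk
  rw [exp_neg_kingFreeS L M₀ ha hL hmsq m k φ',
    density_transport_engine (torCongr (cubeSide_add L M₀ m k)) (Qmat (L ^ k) (cubeSide (d := d) M₀ L m)) hδ hOpc hOps hak hs
      hE.symm φ']
  congr 1
  refine integral_congr_ae (Filter.Eventually.of_forall fun φ => ?_)
  beta_reduce
  rw [exp_neg_kingFreeS L M₀ ha hL hmsq (m + k) 0 φ]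
  rfl

/-- **(2.15) `T_{a,L}∘T_{a_k,L^k} = T_{a_{k+1},L^{k+1}}` AT THE LEVEL OF INTEGRALS (free field)**: the two integral representations of
`exp(−S_m^{(k+1)})` — ONE MORE STEP `T_{a,L}` applied to the level-`k` density at depth `m+1` (★★★ `exp_neg_kingFreeS_succ`), and ONE SHOT
`T_{a_{k+1},L^{k+1}}` from the bare density at depth `m+k+1` (★★ `exp_neg_kingFreeS_eq_blockSpin_bare`) — are EQUAL.
[cite: King1986, (2.13)–(2.15) p.653] -/
theorem king215_freeField {a msq : ℝ} (ha : 0 < a) (hL : 2 ≤ L) (hmsq : 0 < msq) (m k : ℕ)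
    (φ' : Tor (cubeSide (d := d) M₀ L m) → ℝ) :
    Real.sqrt (a / (2 * π)) ^ Fintype.card (Tor (cubeSide (d := d) M₀ L m))
        * ∫ φ : Tor (cubeSide (d := d) M₀ L (m + 1)) → ℝ,
            Real.exp (-(1 / 2 : ℝ) * (a * ((φ' - kingBlockAvg L M₀ m φ) ⬝ᵥ (φ' - kingBlockAvg L M₀ m φ))))
              * Real.exp (-kingFreeS L M₀ a msq (m + 1) k φ)
      = Real.sqrt (aK a L (k + 1) / (2 * π)) ^ Fintype.card (Tor (cubeSide (d := d) M₀ L m))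
        * ∫ φ : Tor (cubeSide (d := d) M₀ L (m + (k + 1))) → ℝ,
            Real.exp (-(1 / 2 : ℝ) * (aK a L (k + 1)
                * ((φ' - kingBlockAvgK L M₀ m (k + 1) φ) ⬝ᵥ (φ' - kingBlockAvgK L M₀ m (k + 1) φ))))
              * Real.exp (-kingFreeS L M₀ a msq (m + (k + 1)) 0 φ) := by
  rw [← exp_neg_kingFreeS_succ ha hL hmsq m k φ',
    exp_neg_kingFreeS_eq_blockSpin_bare ha hL hmsq m (Nat.succ_le_succ (Nat.zero_le k)) φ']

end KFold

end Summit.QuantumFields.YangMills.BalabanUVNodes.N15KingModelRung.FreeField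

end
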